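import Summits.HodgeConjecture.CorCM.Census.OcticTwistResidualCC
import Summits.HodgeConjecture.CorCM.Census.OcticTwistResidualPrep

/-!
# The octic twist `(ℤ/8 × B, (4,0))`, VIII: RESIDUAL SLICES — gathering by D-moves and the quartic residual theorem in the slices at `cst 0`

COR-CM (cell `pub-hodgecm2`), count-neutral kernel combinatorics by the binder seat b09 (gen 33; lane COINVARIANT-TWIST / OCTIC RECON, design
step 3 (ii)–(iii) of `HOME/pub-hodgecm2-b09/lean-g33/COINVARIANT-TWIST.md` PART C), on top of parts I–VII (`Census/OcticTwist*.lean`: `tens`,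
slices `emb₀/emb₁`, `pairVec₂`, **`residual_mem'`**) and the quartic residual vectors (`Census/QuarticTwistResidual.lean`: `Xvec`, `Wvec`,
`IsRes1`) used BY NAME.  One bookkeeping definition with body (`cstSupp`, the vectors supported on the constant-constant types) + theorems;
no `decide` beyond closed numerals of `ZMod 4`, no certificate, no named fact, no `sorry`.
HONEST FRAMING: `HC_CM` is NOT proved; nothing here is a period or a headline.

CONTENT (`N₂` any submodule of octic exponent vectors; `M := N₂ ⊔ cstSupp`).
* §1 `cstSupp`, the submodule of vectors supported on the constant-constant pair types, and outer products landing in it.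
* §2 **GATHERING**: if `N₂` contains the D-moves `(e_{u+kδ_b} − e_u) ⊗ (e_{cst u′} − e_{cst u″})` (`k = ±1`), then for every `v` supported on the
  small residual types `v ⊗ (e_{cst u′} − e_{cst u″}) ∈ M` (`gather₀_mem`; atom by atom, constants go to `cstSupp`); symmetrically `gather₁_mem`.
* §3 **SLICES**: the residual quartic pairs lift into the slice at `cst 0` —
  `(e_s + e_{s+2}) ⊗ e_{cst 0} = pair₂(s, cst 2) + e_s ⊗ (e_{cst 0} − e_{cst 2})` (`pairVec_tens_mem`) — so `residual_mem'` applies in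
  `{v | v ⊗ e_{cst 0} ∈ M}`: **every quartic Hodge vector `v` on the small residual types has `v ⊗ e_{cst 0} ∈ M`** as soon as `N₂` contains the
  octic pairs, `X_{u,b} ⊗ e_{cst 0}`, `w_u ⊗ e_{cst 0}` and the D-moves (`slice₀_mem`); symmetrically `e_{cst 0} ⊗ w ∈ M` (`slice₁_mem`).
Part IX (`Census/OcticTwistResidual.lean`) assembles these into the octic residual theorem.

## References
* [Pohlmann1968] H. Pohlmann, Algebraic cycles on abelian varieties of complex multiplication type, Ann. of Math. 88 (1968), Thm 1.
-/

namespace Summit.HodgeConjecture.CorCM.Census.OcticTwist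

open Finset
open Summit.HodgeConjecture.CorCM.Census.QuarticTwist

variable (B : Type) [AddGroup B] [Fintype B] [DecidableEq B]

/-! ## §1 Vectors supported on the constant-constant types -/

/-- The exponent vectors supported on the constant-constant pair types. [folklore] -/
def cstSupp : Submodule ℤ (Ty₂ B → ℤ) where
  carrier := {v | ∀ T, v T ≠ 0 → ∃ u u' : ZMod 4, T = (cst B u, cst B u')}
  zero_mem' := fun T h => (h rfl).elim
  add_mem' := by
    intro v w hv hw T hT
    rw [Pi.add_apply] at hT
    by_cases h : v T = 0
    · rw [h, zero_add] at hT
      exact hw T hT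
    · exact hv T h
  smul_mem' := by
    intro c v hv T hT
    rw [Pi.smul_apply, smul_eq_mul] at hT
    exact hv T fun h => hT (by rw [h, mul_zero])

omit [AddGroup B] [Fintype B] [DecidableEq B] in
/-- Membership in `cstSupp`. [folklore] -/
theorem mem_cstSupp_iff (v : Ty₂ B → ℤ) : v ∈ cstSupp B ↔ ∀ T, v T ≠ 0 → ∃ u u' : ZMod 4, T = (cst B u, cst B u') := Iff.rfl

omit [AddGroup B] [DecidableEq B] in
/-- `c ⊗ e_t ∈ cstSupp` for `c` supported on constants and `t` constant. [folklore] -/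
theorem tens_mem_cstSupp_left {c : Ty B → ℤ} (hc : ∀ s, c s ≠ 0 → ∃ u, s = cst B u) (u' : ZMod 4) :
    tens B c (Pi.single (cst B u') 1) ∈ cstSupp B := by
  intro T hT
  have h1 : c T.1 ≠ 0 := fun h => hT (by show c T.1 * _ = 0; rw [h, zero_mul])
  have h2 : (Pi.single (cst B u') (1 : ℤ) : Ty B → ℤ) T.2 ≠ 0 := fun h => hT (by show c T.1 * _ = 0; rw [h, mul_zero])
  obtain ⟨u, hu⟩ := hc T.1 h1
  rw [Pi.single_apply] at h2
  have ht : T.2 = cst B u' := by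
    by_contra h
    exact h2 (if_neg h)
  exact ⟨u, u', Prod.ext hu ht⟩

omit [AddGroup B] [DecidableEq B] in
/-- `e_s ⊗ c ∈ cstSupp` for `c` supported on constants and `s` constant. [folklore] -/
theorem tens_mem_cstSupp_right {c : Ty B → ℤ} (hc : ∀ t, c t ≠ 0 → ∃ u, t = cst B u) (u : ZMod 4) :
    tens B (Pi.single (cst B u) 1) c ∈ cstSupp B := by
  intro T hT
  have h2 : c T.2 ≠ 0 := fun h => hT (by show _ * c T.2 = 0; rw [h, mul_zero])
  have h1 : (Pi.single (cst B u) (1 : ℤ) : Ty B → ℤ) T.1 ≠ 0 := fun h => hT (by show _ * c T.2 = 0; rw [h, zero_mul])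
  obtain ⟨u', hu'⟩ := hc T.2 h2
  rw [Pi.single_apply] at h1
  have hs : T.1 = cst B u := by
    by_contra h
    exact h1 (if_neg h)
  exact ⟨u, u', Prod.ext hs hu'⟩

omit [AddGroup B] [DecidableEq B] in
/-- The difference `e_{cst u′} − e_{cst u″}` is supported on constants. [folklore] -/
theorem cst_sub_supp (u' u'' : ZMod 4) (t : Ty B) (ht : (Pi.single (cst B u') (1 : ℤ) - Pi.single (cst B u'') 1 : Ty B → ℤ) t ≠ 0) :
    ∃ u, t = cst B u := by
  rw [Pi.sub_apply, Pi.single_apply, Pi.single_apply] at ht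
  by_cases h1 : t = cst B u'
  · exact ⟨u', h1⟩
  by_cases h2 : t = cst B u''
  · exact ⟨u'', h2⟩
  rw [if_neg h1, if_neg h2, sub_zero] at ht
  exact (ht rfl).elim

/-! ## §2 Gathering: `v ⊗ (e_{cst u′} − e_{cst u″})` for `v` on the small residual types -/

omit [AddGroup B] in
/-- **Gathering in the first coordinate**: with the D-moves `(e_a − e_u) ⊗ (e_{cst u′} − e_{cst u″})` in `N₂`, every `v` supported on the small
residual types has `v ⊗ (e_{cst u′} − e_{cst u″}) ∈ N₂ ⊔ cstSupp`. [folklore] -/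
theorem gather₀_mem {N₂ : Submodule ℤ (Ty₂ B → ℤ)}
    (hD : ∀ (u : ZMod 4) (b : B) (k : ZMod 4) (u' u'' : ZMod 4), (k = 1 ∨ k = -1) →
      tens B (Pi.single (atom B u b k) 1 - Pi.single (cst B u) 1) (Pi.single (cst B u') 1 - Pi.single (cst B u'') 1) ∈ N₂)
    {v : Ty B → ℤ} (hv : ∀ s, v s ≠ 0 → IsRes1 B s) (u' u'' : ZMod 4) :
    tens B v (Pi.single (cst B u') 1 - Pi.single (cst B u'') 1) ∈ N₂ ⊔ cstSupp B := by
  have e : v = ∑ s, v s • (Pi.single s (1 : ℤ) : Ty B → ℤ) := by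
    conv_lhs => rw [← Finset.univ_sum_single v]
    refine Finset.sum_congr rfl fun s _ => ?_
    funext s'
    rw [Pi.smul_apply, Pi.single_apply, Pi.single_apply, smul_eq_mul]
    split_ifs <;> simp
  rw [e, tens_sum_left]
  refine Submodule.sum_mem _ fun s _ => ?_
  rw [tens_smul_left]
  by_cases h0 : v s = 0
  · rw [h0, zero_smul]
    exact Submodule.zero_mem _
  refine Submodule.smul_mem _ _ ?_
  obtain ⟨u, b, k, hk, rfl⟩ := hv s h0
  rcases hk with rfl | hk
  · rw [atom_zero]
    exact Submodule.mem_sup_right (tens_mem_cstSupp_right B (cst_sub_supp B u' u'') u)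
  · have e2 : tens B (Pi.single (atom B u b k) 1) (Pi.single (cst B u') 1 - Pi.single (cst B u'') 1) =
        tens B (Pi.single (atom B u b k) 1 - Pi.single (cst B u) 1) (Pi.single (cst B u') 1 - Pi.single (cst B u'') 1) +
          tens B (Pi.single (cst B u) 1) (Pi.single (cst B u') 1 - Pi.single (cst B u'') 1) := by
      rw [← tens_add_left, sub_add_cancel]
    rw [e2]
    exact Submodule.add_mem _ (Submodule.mem_sup_left (hD u b k u' u'' hk))
      (Submodule.mem_sup_right (tens_mem_cstSupp_right B (cst_sub_supp B u' u'') u))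

omit [AddGroup B] in
/-- **Gathering in the second coordinate** (symmetric). [folklore] -/
theorem gather₁_mem {N₂ : Submodule ℤ (Ty₂ B → ℤ)}
    (hD : ∀ (u : ZMod 4) (b : B) (k : ZMod 4) (u' u'' : ZMod 4), (k = 1 ∨ k = -1) →
      tens B (Pi.single (cst B u') 1 - Pi.single (cst B u'') 1) (Pi.single (atom B u b k) 1 - Pi.single (cst B u) 1) ∈ N₂)
    {w : Ty B → ℤ} (hw : ∀ t, w t ≠ 0 → IsRes1 B t) (u' u'' : ZMod 4) :
    tens B (Pi.single (cst B u') 1 - Pi.single (cst B u'') 1) w ∈ N₂ ⊔ cstSupp B := by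
  have e : w = ∑ t, w t • (Pi.single t (1 : ℤ) : Ty B → ℤ) := by
    conv_lhs => rw [← Finset.univ_sum_single w]
    refine Finset.sum_congr rfl fun t _ => ?_
    funext t'
    rw [Pi.smul_apply, Pi.single_apply, Pi.single_apply, smul_eq_mul]
    split_ifs <;> simp
  have tens_sum_right : ∀ (S : Finset (Ty B)) (f : Ty B → Ty B → ℤ) (v : Ty B → ℤ),
      tens B v (∑ i ∈ S, f i) = ∑ i ∈ S, tens B v (f i) := by
    intro S f v
    funext T
    rw [Finset.sum_apply]
    show v T.1 * (∑ i ∈ S, f i) T.2 = ∑ i ∈ S, v T.1 * f i T.2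
    rw [Finset.sum_apply, Finset.mul_sum]
  rw [e, tens_sum_right]
  refine Submodule.sum_mem _ fun t _ => ?_
  rw [tens_smul_right]
  by_cases h0 : w t = 0
  · rw [h0, zero_smul]
    exact Submodule.zero_mem _
  refine Submodule.smul_mem _ _ ?_
  obtain ⟨u, b, k, hk, rfl⟩ := hw t h0
  rcases hk with rfl | hk
  · rw [atom_zero]
    exact Submodule.mem_sup_right (tens_mem_cstSupp_left B (cst_sub_supp B u' u'') u)
  · have e2 : tens B (Pi.single (cst B u') 1 - Pi.single (cst B u'') 1) (Pi.single (atom B u b k) 1) =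
        tens B (Pi.single (cst B u') 1 - Pi.single (cst B u'') 1) (Pi.single (atom B u b k) 1 - Pi.single (cst B u) 1) +
          tens B (Pi.single (cst B u') 1 - Pi.single (cst B u'') 1) (Pi.single (cst B u) 1) := by
      rw [← tens_add_right, sub_add_cancel]
    rw [e2]
    exact Submodule.add_mem _ (Submodule.mem_sup_left (hD u b k u' u'' hk))
      (Submodule.mem_sup_right (tens_mem_cstSupp_left B (cst_sub_supp B u' u'') u))

/-! ## §3 The slices at `cst 0`: residual pairs lift, and `residual_mem'` applies -/

omit [Fintype B] [DecidableEq B] [AddGroup B] in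
/-- `cst 2 + 2 = cst 0`. [folklore] -/
theorem cst_two_add_two : cst B 2 + 2 = cst B 0 := by
  rw [cst_add_two, show (2 : ZMod 4) + 2 = 0 by decide]

omit [AddGroup B] in
/-- **Residual quartic pairs lift into the slice**: `(e_s + e_{s+2}) ⊗ e_{cst 0} = pair₂(s, cst 2) + e_s ⊗ (e_{cst 0} − e_{cst 2})`, in
`N₂ ⊔ cstSupp` for small residual `s`. [folklore] -/
theorem pairVec_tens_mem {N₂ : Submodule ℤ (Ty₂ B → ℤ)} (hP : pairs₂ B ≤ N₂)
    (hD : ∀ (u : ZMod 4) (b : B) (k : ZMod 4) (u' u'' : ZMod 4), (k = 1 ∨ k = -1) →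
      tens B (Pi.single (atom B u b k) 1 - Pi.single (cst B u) 1) (Pi.single (cst B u') 1 - Pi.single (cst B u'') 1) ∈ N₂)
    {s : Ty B} (hs : IsRes1 B s) : tens B (pairVec B s) (Pi.single (cst B 0) 1) ∈ N₂ ⊔ cstSupp B := by
  have e : tens B (pairVec B s) (Pi.single (cst B 0) 1) =
      pairVec₂ B (s, cst B 2) + tens B (Pi.single s 1) (Pi.single (cst B 0) 1 - Pi.single (cst B 2) 1) := by
    unfold pairVec pairVec₂
    rw [tens_add_left, tens_sub_right, single_eq_tens, single_eq_tens]
    show _ = tens B (Pi.single s 1) (Pi.single (cst B 2) 1) + tens B (Pi.single (s + 2) 1) (Pi.single (cst B 2 + 2) 1) + _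
    rw [cst_two_add_two]
    abel
  rw [e]
  refine Submodule.add_mem _ (Submodule.mem_sup_left (hP (pairVec₂_mem_pairs₂ B _))) ?_
  refine gather₀_mem B hD (fun t ht => ?_) 0 2
  rw [Pi.single_apply] at ht
  by_cases h : t = s
  · rw [h]; exact hs
  · rw [if_neg h] at ht; exact (ht rfl).elim

omit [AddGroup B] in
/-- Symmetric: `e_{cst 0} ⊗ (e_t + e_{t+2}) = pair₂(cst 2, t) + (e_{cst 0} − e_{cst 2}) ⊗ e_t`. [folklore] -/
theorem tens_pairVec_mem {N₂ : Submodule ℤ (Ty₂ B → ℤ)} (hP : pairs₂ B ≤ N₂)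
    (hD : ∀ (u : ZMod 4) (b : B) (k : ZMod 4) (u' u'' : ZMod 4), (k = 1 ∨ k = -1) →
      tens B (Pi.single (cst B u') 1 - Pi.single (cst B u'') 1) (Pi.single (atom B u b k) 1 - Pi.single (cst B u) 1) ∈ N₂)
    {t : Ty B} (ht : IsRes1 B t) : tens B (Pi.single (cst B 0) 1) (pairVec B t) ∈ N₂ ⊔ cstSupp B := by
  have e : tens B (Pi.single (cst B 0) 1) (pairVec B t) =
      pairVec₂ B (cst B 2, t) + tens B (Pi.single (cst B 0) 1 - Pi.single (cst B 2) 1) (Pi.single t 1) := by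
    unfold pairVec pairVec₂
    rw [tens_add_right, tens_sub_left, single_eq_tens, single_eq_tens]
    show _ = tens B (Pi.single (cst B 2) 1) (Pi.single t 1) + tens B (Pi.single (cst B 2 + 2) 1) (Pi.single (t + 2) 1) + _
    rw [cst_two_add_two]
    abel
  rw [e]
  refine Submodule.add_mem _ (Submodule.mem_sup_left (hP (pairVec₂_mem_pairs₂ B _))) ?_
  refine gather₁_mem B hD (fun t' ht' => ?_) 0 2
  rw [Pi.single_apply] at ht'
  by_cases h : t' = t
  · rw [h]; exact ht
  · rw [if_neg h] at ht'; exact (ht' rfl).elim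

omit [AddGroup B] in
/-- **SLICE AT `cst 0`, first coordinate** (`|B| ≥ 3`): a quartic Hodge vector `v` on the small residual types has `v ⊗ e_{cst 0} ∈ N₂ ⊔ cstSupp`,
by `residual_mem'` in the slice. [folklore] -/
theorem slice₀_mem (h3 : 3 ≤ Fintype.card B) {N₂ : Submodule ℤ (Ty₂ B → ℤ)} (hP : pairs₂ B ≤ N₂)
    (hX : ∀ (u : ZMod 4) (b : B), tens B (Xvec B u b) (Pi.single (cst B 0) 1) ∈ N₂)
    (hW : ∀ u : ZMod 4, tens B (Wvec B u) (Pi.single (cst B 0) 1) ∈ N₂)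
    (hD : ∀ (u : ZMod 4) (b : B) (k : ZMod 4) (u' u'' : ZMod 4), (k = 1 ∨ k = -1) →
      tens B (Pi.single (atom B u b k) 1 - Pi.single (cst B u) 1) (Pi.single (cst B u') 1 - Pi.single (cst B u'') 1) ∈ N₂)
    {v : Ty B → ℤ} (hv : v ∈ hodge B) (hsupp : ∀ s, v s ≠ 0 → IsRes1 B s) :
    tens B v (Pi.single (cst B 0) 1) ∈ N₂ ⊔ cstSupp B := by
  have key := residual_mem' B h3 (N := (N₂ ⊔ cstSupp B).comap (emb₀ B (cst B 0)))
    (fun s hs => pairVec_tens_mem B hP hD hs) (fun u b => Submodule.mem_sup_left (hX u b)) (fun u => Submodule.mem_sup_left (hW u)) hv hsupp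
  exact key

omit [AddGroup B] in
/-- **SLICE AT `cst 0`, second coordinate** (symmetric). [folklore] -/
theorem slice₁_mem (h3 : 3 ≤ Fintype.card B) {N₂ : Submodule ℤ (Ty₂ B → ℤ)} (hP : pairs₂ B ≤ N₂)
    (hX : ∀ (u : ZMod 4) (b : B), tens B (Pi.single (cst B 0) 1) (Xvec B u b) ∈ N₂)
    (hW : ∀ u : ZMod 4, tens B (Pi.single (cst B 0) 1) (Wvec B u) ∈ N₂)
    (hD : ∀ (u : ZMod 4) (b : B) (k : ZMod 4) (u' u'' : ZMod 4), (k = 1 ∨ k = -1) →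
      tens B (Pi.single (cst B u') 1 - Pi.single (cst B u'') 1) (Pi.single (atom B u b k) 1 - Pi.single (cst B u) 1) ∈ N₂)
    {w : Ty B → ℤ} (hw : w ∈ hodge B) (hsupp : ∀ t, w t ≠ 0 → IsRes1 B t) :
    tens B (Pi.single (cst B 0) 1) w ∈ N₂ ⊔ cstSupp B := by
  have key := residual_mem' B h3 (N := (N₂ ⊔ cstSupp B).comap (emb₁ B (cst B 0)))
    (fun t ht => tens_pairVec_mem B hP hD ht) (fun u b => Submodule.mem_sup_left (hX u b)) (fun u => Submodule.mem_sup_left (hW u)) hw hsupp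
  exact key

end Summit.HodgeConjecture.CorCM.Census.OcticTwist
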